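import Literature.MathematicalPhysics.QuantumLattice.BogoliubovInequality
import HarnessLib

/-!
# Bogoliubov's inequality, sharp (Duhamel) form

Topic `Literature/MathematicalPhysics/QuantumLattice`. Everything here is PROVED (no named fact, no
definition). Companion to `BogoliubovInequality.lean`: for a Hermitian Hamiltonian
`H : Matrix n n ℂ`, `β ≥ 0`, the Gibbs state `⟨X⟩ = tr(e^{-βH} X)/Z` (`Matrix.gibbsState β H`) and
the Duhamel two-point function `(A, B) = Z⁻¹ ∫₀¹ tr(A e^{-sβH} B e^{-(1-s)βH}) ds`
(`Matrix.duhamel β H A B`, `DuhamelTwoPoint.lean`), Dyson–Lieb–Simon (1978) §2 prove Bogoliubov's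
inequality in the **sharp form**
`|⟨[C, A]⟩|² ≤ (A, A†) · β⟨[C†, [H, C]]⟩`
(Schwarz's inequality `|(A,B)|² ≤ (A,A†)(B†,B)` for the Duhamel scalar product, eq. (22'), at
`B = [C†, βH]`, using `⟨[A, B]⟩ = (A, [B, βH])`-type identity (27) and the chain before (28));
the classical form with `½⟨A†A + AA†⟩` in place of `(A, A†)` follows from `(A, A†) ≤ ½⟨A†A + AA†⟩`
(their Thm. 3.1). This file proves, for **Hermitian** `A` and `C`:

* `bogoliubov_inequality_duhamel`:
  `‖⟨CA - AC⟩‖² ≤ β · Re (A, A) · Re ⟨[C, [H, C]]⟩` (`[C,[H,C]] = C(HC - CH) - (HC - CH)C` as in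
  `DuhamelTwoPoint.lean`; both real parts are of real numbers);
* `re_duhamel_self_le_re_gibbsState_sq`: `Re (A, A) ≤ Re ⟨A²⟩`, by which the sharp form implies
  `bogoliubov_inequality`.

The proof of the first is that of `bogoliubov_inequality` on the pair sums of
`DuhamelTwoPoint.lean` in an eigenbasis of `H` (`A' = U⋆AU`, `wᵢ = e^{-βEᵢ}`,
`K = duhamelKernel β Eᵢ Eⱼ` the logarithmic mean): `Z⟨CA - AC⟩ = Σᵢⱼ (wᵢ - wⱼ) C'ᵢⱼ conj(A'ᵢⱼ)`
(`trace_gibbsWeight_mul_comm_sub`), the per-pair **identity**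
`(wᵢ - wⱼ)² = β K(Eᵢ,Eⱼ) (Eⱼ - Eᵢ)(wᵢ - wⱼ)` (`Matrix.sq_exp_sub_exp_eq`) — an equality, where the
classical proof uses `K ≤ ½(wᵢ + wⱼ)`, i.e. `tanh x ≤ x` — and Cauchy–Schwarz over pairs;
`Σᵢⱼ ‖A'ᵢⱼ‖² K(Eᵢ,Eⱼ) = Z · Re (A, A)` and `Σᵢⱼ ‖C'ᵢⱼ‖² (Eⱼ - Eᵢ)(wᵢ - wⱼ) = Z⟨[C,[H,C]]⟩` are
`Matrix.IsHermitian.re_duhamel_self` and `Matrix.IsHermitian.re_gibbsState_doubleComm`. The second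
is `K ≤ ½(wᵢ + wⱼ)` (`duhamelKernel_le_half_add_exp`) summed against `‖A'ᵢⱼ‖²`.

## References

* F. J. Dyson, E. H. Lieb, B. Simon, *Phase transitions in quantum spin systems with isotropic and
  nonisotropic interactions*, J. Stat. Phys. 18 (1978) 335–383, §2 eqs. (22'), (27), (28) and
  Thm. 3.1 [DLS1978].
* D. C. Mattis, *The Theory of Magnetism Made Simple* (2006), §7.15, eqs. (7.224)–(7.231) (the
  eigenbasis proof via the scalar product `(A,B) = Σᵢⱼ (i|A|j)* (i|B|j) (Wᵢ - Wⱼ)/(Eⱼ - Eᵢ)`)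
  [Mattis2006].
* N. D. Mermin, H. Wagner, Phys. Rev. Lett. 17 (1966) 1133–1136 [MerminWagnerPRL1966].

## Design notes

Everything is over `ℂ`, `[Fintype n] [DecidableEq n]`, using Mathlib's `Matrix.gibbsState` and the
project's `Matrix.duhamel` / `Matrix.duhamelKernel`; no new definition is introduced. The statement
shape (norms, `.re`, the commutators written out) is literally that of `bogoliubov_inequality` with
`gibbsState β H (A * A)` replaced by `duhamel β H A A`, so downstream users can swap one for the
other.
-/

noncomputable section

open scoped Matrix.Norms.L2Operator ComplexOrder
open Finset MeasureTheory intervalIntegral Matrix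

namespace Literature.MathematicalPhysics.QuantumLattice

variable {n : Type*} [Fintype n] [DecidableEq n]

section Spectral

variable {H : Matrix n n ℂ}

/-- **Bogoliubov's inequality, sharp (Duhamel) form.** For Hermitian `H`, `A`, `C` and `β ≥ 0`,
`|⟨CA - AC⟩_β|² ≤ β · Re (A, A)_β · ⟨[C, [H, C]]⟩_β`, where `(A, A)_β = Matrix.duhamel β H A A` is
the Duhamel two-point function `Z⁻¹ ∫₀¹ tr(A e^{-sβH} A e^{-(1-s)βH}) ds` and
`[C,[H,C]] = C(HC - CH) - (HC - CH)C`. This is the Schwarz inequality for the Duhamel scalar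
product, `|(A, B)|² ≤ (A, A)(B, B)` ([DLS1978] (22')), evaluated at `B = [C†, βH]` with the
identities `⟨[C, A]⟩ = (A, [C†, βH])` ([DLS1978] (27)) and `([C†,βH],[C†,βH]) = β⟨[C†,[H,C]]⟩`
(the chain before [DLS1978] (28)); since `(A, A) ≤ ½⟨A†A + AA†⟩` ([DLS1978] Thm. 3.1, here
`duhamelKernel_le_half_add_exp`) it implies `bogoliubov_inequality`. Proof: in an eigenbasis
`Z⟨CA - AC⟩ = Σᵢⱼ (wᵢ - wⱼ) C'ᵢⱼ conj A'ᵢⱼ` (`trace_gibbsWeight_mul_comm_sub`), the per-pair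
*identity* `(wᵢ - wⱼ)² = β K(Eᵢ,Eⱼ) (Eⱼ - Eᵢ)(wᵢ - wⱼ)` (`Matrix.sq_exp_sub_exp_eq`) and
Cauchy–Schwarz over pairs; `Σ ‖A'ᵢⱼ‖² K(Eᵢ,Eⱼ) = Z·Re(A,A)` and
`Σ ‖C'ᵢⱼ‖² (Eⱼ - Eᵢ)(wᵢ - wⱼ) = Z⟨[C,[H,C]]⟩` are `Matrix.IsHermitian.re_duhamel_self` and
`Matrix.IsHermitian.re_gibbsState_doubleComm`.
[cite: DLS1978, §2 eqs. (22'), (27), (28)] [cite: Mattis2006, §7.15 eqs. (7.224)–(7.231)] -/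
theorem bogoliubov_inequality_duhamel (hH : H.IsHermitian) {A C : Matrix n n ℂ}
    (hA : A.IsHermitian) (hC : C.IsHermitian) {β : ℝ} (hβ : 0 ≤ β) :
    ‖gibbsState β H (C * A - A * C)‖ ^ 2 ≤
      β * (duhamel β H A A).re *
        (gibbsState β H (C * (H * C - C * H) - (H * C - C * H) * C)).re := by
  rcases isEmpty_or_nonempty n with hn | hn
  · have h0 : ∀ X : Matrix n n ℂ, gibbsState β H X = 0 := fun X => by
      rw [gibbsState_apply]
      simp [Matrix.trace]
    simp [h0]
  -- abbreviations
  set U := (hH.eigenvectorUnitary : Matrix n n ℂ) with hU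
  set E := hH.eigenvalues with hE
  set W : n → ℝ := fun i => Real.exp (-(β * E i)) with hW
  set Zr : ℝ := ∑ i, W i with hZr
  set a : n → n → ℝ := fun i j => ‖(star U * A * U) i j‖ with ha
  set c' : n → n → ℝ := fun i j => ‖(star U * C * U) i j‖ with hc'
  set c : n → n → ℝ := fun i j => (E j - E i) * (W i - W j) with hc
  set K : n → n → ℝ := fun i j => duhamelKernel β (E i) (E j) with hK
  have hZr0 : 0 < Zr := hH.sum_exp_pos β
  have hc0 : ∀ i j, 0 ≤ c i j := fun i j => sub_mul_exp_sub_exp_nonneg hβ (E i) (E j)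
  have hK0 : ∀ i j, 0 ≤ K i j := fun i j => (duhamelKernel_pos β (E i) (E j)).le
  -- the left-hand side as a pair sum
  have hL : gibbsState β H (C * A - A * C) =
      (Zr : ℂ)⁻¹ * ∑ i, ∑ j, ((W i - W j : ℝ) : ℂ) *
        ((star U * C * U) i j * star ((star U * A * U) i j)) := by
    rw [gibbsState_apply, hH.partitionFn_eq_ofReal, trace_gibbsWeight_mul_comm_sub hH hA C β]
  have hLn : ‖gibbsState β H (C * A - A * C)‖ ≤
      Zr⁻¹ * ∑ i, ∑ j, |W i - W j| * (c' i j * a i j) := by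
    rw [hL, norm_mul, norm_inv, Complex.norm_real, Real.norm_eq_abs, abs_of_pos hZr0]
    refine mul_le_mul_of_nonneg_left ?_ (inv_nonneg.2 hZr0.le)
    refine (norm_sum_le _ _).trans (sum_le_sum fun i _ => ?_)
    refine (norm_sum_le _ _).trans (sum_le_sum fun j _ => ?_)
    rw [norm_mul, norm_mul, norm_star, Complex.norm_real, Real.norm_eq_abs]
  -- the two right-hand factors as pair sums
  have hg : (duhamel β H A A).re = Zr⁻¹ * ∑ i, ∑ j, a i j ^ 2 * K i j := by
    rw [hH.re_duhamel_self hA β]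
  have hcc : (gibbsState β H (C * (H * C - C * H) - (H * C - C * H) * C)).re =
      Zr⁻¹ * ∑ i, ∑ j, c' i j ^ 2 * c i j := by
    rw [hH.re_gibbsState_doubleComm hC β]
  -- per-pair identity (as an inequality) and Cauchy–Schwarz
  have hpair : ∀ i j, |W i - W j| * (c' i j * a i j) ≤
      Real.sqrt (β * (a i j ^ 2 * K i j)) * Real.sqrt (c' i j ^ 2 * c i j) := by
    intro i j
    have ha0 : 0 ≤ a i j := norm_nonneg _
    have hc'0 : 0 ≤ c' i j := norm_nonneg _
    rw [← Real.sqrt_mul (mul_nonneg hβ (mul_nonneg (sq_nonneg _) (hK0 i j))),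
      show β * (a i j ^ 2 * K i j) * (c' i j ^ 2 * c i j) =
        (c' i j * a i j) ^ 2 * (β * K i j * c i j) by ring,
      Real.sqrt_mul (sq_nonneg _), Real.sqrt_sq (mul_nonneg hc'0 ha0), mul_comm]
    refine mul_le_mul_of_nonneg_left ?_ (mul_nonneg hc'0 ha0)
    rw [← Real.sqrt_sq_eq_abs]
    exact Real.sqrt_le_sqrt (le_of_eq (sq_exp_sub_exp_eq β (E i) (E j)))
  have hsum : ∑ i, ∑ j, |W i - W j| * (c' i j * a i j) ≤
      Real.sqrt (∑ i, ∑ j, β * (a i j ^ 2 * K i j)) *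
        Real.sqrt (∑ i, ∑ j, c' i j ^ 2 * c i j) := by
    calc ∑ i, ∑ j, |W i - W j| * (c' i j * a i j)
        ≤ ∑ i, ∑ j, Real.sqrt (β * (a i j ^ 2 * K i j)) *
            Real.sqrt (c' i j ^ 2 * c i j) :=
          sum_le_sum fun i _ => sum_le_sum fun j _ => hpair i j
      _ ≤ _ := by
          have hCS := Real.sum_sqrt_mul_sqrt_le (univ : Finset (n × n))
            (f := fun p => β * (a p.1 p.2 ^ 2 * K p.1 p.2))
            (g := fun p => c' p.1 p.2 ^ 2 * c p.1 p.2)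
            (fun p => mul_nonneg hβ (mul_nonneg (sq_nonneg _) (hK0 _ _)))
            (fun p => mul_nonneg (sq_nonneg _) (hc0 _ _))
          simpa only [Fintype.sum_prod_type] using hCS
  -- assemble
  set G : ℝ := ∑ i, ∑ j, a i j ^ 2 * K i j with hG
  set D : ℝ := ∑ i, ∑ j, c' i j ^ 2 * c i j with hD
  have hG0 : 0 ≤ G := sum_nonneg fun i _ => sum_nonneg fun j _ =>
    mul_nonneg (sq_nonneg _) (hK0 _ _)
  have hD0 : 0 ≤ D := sum_nonneg fun i _ => sum_nonneg fun j _ =>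
    mul_nonneg (sq_nonneg _) (hc0 _ _)
  have hβG : ∑ i, ∑ j, β * (a i j ^ 2 * K i j) = β * G := by
    rw [hG, mul_sum]
    refine sum_congr rfl fun i _ => ?_
    rw [mul_sum]
  rw [hβG] at hsum
  have hZinv : 0 ≤ Zr⁻¹ := inv_nonneg.2 hZr0.le
  have hn0 : 0 ≤ ‖gibbsState β H (C * A - A * C)‖ := norm_nonneg _
  have hbound : ‖gibbsState β H (C * A - A * C)‖ ≤
      Zr⁻¹ * (Real.sqrt (β * G) * Real.sqrt D) :=
    hLn.trans (mul_le_mul_of_nonneg_left hsum hZinv)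
  rw [hg, hcc]
  calc ‖gibbsState β H (C * A - A * C)‖ ^ 2
      ≤ (Zr⁻¹ * (Real.sqrt (β * G) * Real.sqrt D)) ^ 2 := pow_le_pow_left₀ hn0 hbound 2
    _ = β * (Zr⁻¹ * G) * (Zr⁻¹ * D) := by
        rw [mul_pow, mul_pow, Real.sq_sqrt (mul_nonneg hβ hG0), Real.sq_sqrt hD0]
        ring

/-- The sharp form implies the classical one: `β · Re(A,A) · c ≤ β · ⟨A²⟩ · c` because
`(A, A) ≤ ⟨A²⟩` for Hermitian `A` (logarithmic mean ≤ arithmetic mean). [cite: DLS1978, Thm. 3.1] -/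
theorem re_duhamel_self_le_re_gibbsState_sq (hH : H.IsHermitian) {A : Matrix n n ℂ}
    (hA : A.IsHermitian) (β : ℝ) :
    (duhamel β H A A).re ≤ (gibbsState β H (A * A)).re := by
  rcases isEmpty_or_nonempty n with hn | hn
  · have h0 : ∀ X : Matrix n n ℂ, gibbsState β H X = 0 := fun X => by
      rw [gibbsState_apply]
      simp [Matrix.trace]
    have h1 : duhamel β H A A = 0 := by
      rw [duhamel]
      simp [Matrix.trace]
    simp [h0, h1]
  rw [hH.re_duhamel_self hA β, hH.re_gibbsState_sq hA β]
  set U := (hH.eigenvectorUnitary : Matrix n n ℂ) with hU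
  set E := hH.eigenvalues with hE
  set W : n → ℝ := fun i => Real.exp (-(β * E i)) with hW
  set a : n → n → ℝ := fun i j => ‖(star U * A * U) i j‖ with ha
  have hasymm : ∀ i j, a i j = a j i := by
    intro i j
    simp only [ha]
    rw [← star_apply_rotate hA i j, norm_star]
  refine mul_le_mul_of_nonneg_left ?_ (inv_nonneg.2 (hH.sum_exp_pos β).le)
  have hsw : ∑ i, ∑ j, a i j ^ 2 * W i = ∑ i, ∑ j, a i j ^ 2 * W j := by
    rw [Finset.sum_comm]
    exact sum_congr rfl fun i _ => sum_congr rfl fun j _ => by rw [hasymm j i]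
  have h2 : ∑ i, ∑ j, a i j ^ 2 * W i = ∑ i, ∑ j, a i j ^ 2 * ((W i + W j) / 2) := by
    have : ∑ i, ∑ j, a i j ^ 2 * ((W i + W j) / 2) =
        (∑ i, ∑ j, a i j ^ 2 * W i + ∑ i, ∑ j, a i j ^ 2 * W j) / 2 := by
      rw [← sum_add_distrib, Finset.sum_div]
      refine sum_congr rfl fun i _ => ?_
      rw [← sum_add_distrib, Finset.sum_div]
      refine sum_congr rfl fun j _ => ?_
      ring
    rw [this, ← hsw]
    ring
  rw [h2]
  exact sum_le_sum fun i _ => sum_le_sum fun j _ =>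
    mul_le_mul_of_nonneg_left (duhamelKernel_le_half_add_exp β (E i) (E j)) (sq_nonneg _)

end Spectral

end Literature.MathematicalPhysics.QuantumLattice

end
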